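import Summits.AtomisticToContinuum.BoseEinsteinCondensation.Theorems.BECInsertionCorrectorCorrectorClosureZeroModeFSumMoment
import Summits.AtomisticToContinuum.BoseEinsteinCondensation.Theorems.BECInsertionCorrectorCorrectorClosureConcentrationOfMomentsDictionary
import Summits.AtomisticToContinuum.BoseEinsteinCondensation.Theorems.BECInsertionCorrectorStaticResponseBoundWeightedGap
import HarnessLib

/-!
# A torus spectral gap `γ ≥ C/L³` implies the zero-mode susceptibility bound (sufficient condition for
# the registered stub `stub_zeroModeSusceptibility`, line `volume-homotopy-sum-rule-domination`, crux
# `BECInsertionCorrector.CorrectorClosure`, item stmt-AtomisticToContinuum-12058)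

Supports (does not close) stmt-AtomisticToContinuum-12058: lands the registered sub-stub
`zeroModeSusceptibility_of_torusGap` of the skeleton `Lines/volume_homotopy_sum_rule_domination` (v4).
The open heart S3b (`stub_zeroModeSusceptibility`: the static susceptibility
`A ρ_L N ‖g_Φ − ⟨g_Φ⟩‖²₋₁ ≤ (ζN²)²` of the zero-mode counting ratio `g_Φ = (N̂₀Φ)/Φ` at a real positive
torus minimiser `Φ`) follows from a SPECTRAL GAP of the `(n+2)`-body torus Hamiltonian in Ky Fan dress,
`2E₀ + C/L³ ≤ kyFanTwo v (n+2) L` for every `C`, density-uniformly on the dilute side.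

**Proof** (`F = |Φ| = Φ > 0`, `E₀ = E_v(Φ)` finite, `N = n + 2`).
1. `zg_poincare_of_kyFanGap` — POINCARÉ FROM KY FAN: for a Bose-symmetric periodic test `β` with
   centring `β_c = β − ∫βF²` and mass `m = ∫β_c²F²`, the normalised state `Ψ = cβ_cF` (`c²m = 1`,
   `b3_exists_mulState`) is `L²(cell)`-orthogonal to `Φ`, so `E₀ + E_v(Ψ) ≥ kyFanTwo ≥ 2E₀ + γ`, while
   Davies' ground-state representation (`gsRepresentation`) gives `E_v(Ψ) = E₀ + c²𝓔_F(β_c, β_c)`;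
   hence `γ·m ≤ 𝓔_F(β_c, β_c) = 𝓔_F(β, β)`.
2. `zg_integral_numOp_sq_le` — the zero-mode dictionary: `∫(N̂₀F)² = T₀ + n₀ ≤ (N−1)n₀ + n₀ ≤ N²`
   (`cm_ofReal_integral_numOp_sq`, `pairOcc_le_momentumOccupation`, `condensateOccupation_le_card`).
3. `zg_hMinusOneSqW_le_of_kyFanGap` — the `H₋₁` bound `‖g − ⟨g⟩‖²₋₁ ≤ N²/γ`: symmetric tests suffice
   (`hMinusOneSqW_le_of_symmetric_tests`); for such `β`, `∫(g−⟨g⟩)βF² = ∫(g−⟨g⟩)β_cF²`, Cauchy–Schwarz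
   (`sq_integral_cellN_mul_le`), the variance bound `∫(g−⟨g⟩)²F² ≤ ∫(N̂₀F)² ≤ N²` (Pythagoras
   `vhr_integral_centredRatio_sq`) and step 1 give `(∫(g−⟨g⟩)βF²)² ≤ (N²/γ)·𝓔_F(β,β)`.
4. `zeroModeSusceptibility_of_torusGap` — constants: given `ζ > 0`, `A ≥ 0` take `C = (A+1)/ζ²` in the
   gap hypothesis, `γ = C/L³`, `B = N²L³/C`; then `A·(N/L³)·N·B = A N⁴/C ≤ (ζN²)²`.

References: [ReedSimonIV1978] Thm. XIII.1–2 (min–max for the two lowest levels); [Davies1989] §4.2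
(ground-state transform); [KipnisVaradhan1986] (1.14); [PitaevskiiStringari1991] (9).
-/

noncomputable section

namespace Summit.AtomisticToContinuum.BoseEinsteinCondensation.Theorems.CorrectorClosure.VolumeHomotopySumRuleDomination

open MeasureTheory Filter Matrix
open scoped ENNReal NNReal BigOperators ComplexConjugate
open Literature.MathematicalPhysics.QuantumManyBody.BoseGas
open Literature.MathematicalPhysics.QuantumManyBody
open Summit.AtomisticToContinuum.BoseEinsteinCondensation.Cruxes.StaticResponseBound.UvThomsonForceWave
  (contDiff_norm_of_real measurable_periodicInteraction_of)
open Summit.AtomisticToContinuum.BoseEinsteinCondensation.Theorems.StaticResponseToHMinusOne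
  (gsRepresentation energy_ne_top_of_eq_mul norm_sq_of_eq_mul)
open Summit.AtomisticToContinuum.BoseEinsteinCondensation.Cruxes.StaticResponseBound.StableFractionSquareCompletion
  (b3_exists_mulState)
open Summit.AtomisticToContinuum.BoseEinsteinCondensation.Theorems.StaticResponseBound.Negative
  (integral_norm_sq_eq_one)
open Summit.AtomisticToContinuum.BoseEinsteinCondensation.Cruxes.StaticResponseBound.FewBody
  (sq_integral_cellN_mul_le)
open Summit.AtomisticToContinuum.BoseEinsteinCondensation.Theorems.CorrectorClosure.HealingScaleKacInsertion.ResponseDictionary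
  (hMinusOneSqW_le_of_symmetric_tests)
open Summit.AtomisticToContinuum.BoseEinsteinCondensation.Theorems.SumRuleChainGlue
  (condensateOccupation_le_card pairOcc pairOcc_zero pairOcc_le_momentumOccupation)

variable {n : ℕ} {L : ℝ}

/-! ### Real arithmetic -/

/-- `a² ≤ B·D` with `B, D ≥ 0` forces `2a − D ≤ B` (AM–GM: `2a ≤ 2√(BD) ≤ B + D`). [folklore] -/
theorem zg_two_mul_sub_le_of_sq_le {a B D : ℝ} (hB : 0 ≤ B) (hD : 0 ≤ D) (h : a ^ 2 ≤ B * D) :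
    2 * a - D ≤ B := by
  by_contra hlt
  have h2 : 0 < 2 * a - D - B := by linarith [not_le.1 hlt]
  have h3 : 0 < 2 * a + D + B := by linarith
  nlinarith [mul_pos h2 h3, sq_nonneg (B - D)]

/-! ### Step 1: the weighted Poincaré inequality from the Ky Fan gap -/

/-- **Poincaré inequality for the ground-state Dirichlet form from a Ky Fan gap.** Let `Φ ≥ 0` be a real
finite-energy periodic trial state of `N` bosons attaining the ground-state energy (`F = |Φ|`,
`E₀ = E_v(Φ)`, `v` measurable) and suppose the Ky Fan gap `2E₀ + γ ≤ kyFanTwo v N L`, `γ ≥ 0`. Then for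
every Bose-symmetric periodic test function `β`, with `β̄ = ∫ βF²`,
`γ · ∫ (β − β̄)² F² ≤ 𝓔_F(β, β)`: if `m = ∫(β − β̄)²F² > 0` the normalised state `Ψ = c(β − β̄)F`
(`c²m = 1`) is orthogonal to `Φ` in `L²(cell)`, so `E₀ + E_v(Ψ) ≥ kyFanTwo ≥ 2E₀ + γ`, while the
ground-state representation gives `E_v(Ψ) = E₀ + c²𝓔_F(β, β)`. [cite: ReedSimonIV1978, Thm XIII.1–2] -/
theorem zg_poincare_of_kyFanGap {N : ℕ} {v : ℝ → ℝ≥0∞} (hvm : Measurable v)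
    (Φ : PeriodicTrialState N L) (hreal : ∀ X, Φ.ψ X = (‖Φ.ψ X‖ : ℂ))
    (hE : periodicEnergy v Φ = periodicGroundStateEnergy v N L) (hEfin : periodicEnergy v Φ ≠ ⊤)
    {F : Config N → ℝ} (hF : ∀ X, ‖Φ.ψ X‖ = F X) {γ : ℝ} (hγ : 0 ≤ γ)
    (hgap : 2 * periodicGroundStateEnergy v N L + ENNReal.ofReal γ ≤ kyFanTwo v N L)
    {β : Config N → ℝ} (hβ : IsPeriodicTest L β)
    (hβsymm : ∀ (σ : Equiv.Perm (Fin N)) (X : Config N), β (X ∘ σ) = β X) :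
    γ * ∫ X in cellN N L, (β X - ∫ Y in cellN N L, β Y * F Y ^ 2) ^ 2 * F X ^ 2 ≤
      dirichletFormW L F β β := by
  -- the weight `F = |Φ|`
  have hFfun : (fun X => ‖Φ.ψ X‖) = F := funext hF
  have hFr : ∀ X, Φ.ψ X = (F X : ℂ) := fun X => by rw [← hF X]; exact hreal X
  have hFt : IsPeriodicTest L F := by
    rw [← hFfun]
    exact ⟨contDiff_norm_of_real Φ hreal, fun X i k => by dsimp only; rw [Φ.periodic]⟩
  have hFc : Continuous F := hFt.continuous
  have hF1 : ∫ X in cellN N L, F X ^ 2 = 1 := by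
    have h := integral_norm_sq_eq_one Φ
    simpa only [hF] using h
  -- the centred test function `βc = β - β̄`
  set bbar : ℝ := ∫ Y in cellN N L, β Y * F Y ^ 2 with hbbar
  obtain ⟨βc, hβc_def⟩ : ∃ βc : Config N → ℝ, βc = fun X => β X - bbar := ⟨_, rfl⟩
  have hβcX : ∀ X, β X - bbar = βc X := fun X => by rw [hβc_def]
  simp only [hβcX]
  have hβc : IsPeriodicTest L βc := by rw [hβc_def]; exact hβ.sub (IsPeriodicTest.const L bbar)
  have hβc_symm : ∀ (σ : Equiv.Perm (Fin N)) (X : Config N), βc (X ∘ σ) = βc X := fun σ X => by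
    simp only [hβc_def, hβsymm σ X]
  -- `𝓔_F(βc, βc) = 𝓔_F(β, β)`
  have hDir : dirichletFormW L F βc βc = dirichletFormW L F β β := by
    rw [hβc_def, show (fun X => β X - bbar) = β - fun _ => bbar from rfl,
      dirichletFormW_sub_sub hFc hβ (IsPeriodicTest.const L bbar), dirichletFormW_const_right,
      dirichletFormW_const_left]
    ring
  -- `βc` is centred
  have hcent : ∫ X in cellN N L, βc X * F X ^ 2 = 0 := by
    have i1 : IntegrableOn (fun X => β X * F X ^ 2) (cellN N L) :=
      integrableOn_cellN (hβ.continuous.mul (hFc.pow 2)) L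
    have i2 : IntegrableOn (fun X => bbar * F X ^ 2) (cellN N L) :=
      integrableOn_cellN (continuous_const.mul (hFc.pow 2)) L
    have hpt : ∀ X, βc X * F X ^ 2 = β X * F X ^ 2 - bbar * F X ^ 2 := fun X => by
      rw [hβc_def]; ring
    simp_rw [hpt]
    rw [integral_sub i1 i2, integral_const_mul, hF1, ← hbbar]
    ring
  -- the mass `m = ∫ βc² F²`
  set m : ℝ := ∫ X in cellN N L, βc X ^ 2 * F X ^ 2 with hm_def
  have hm0 : 0 ≤ m := integral_nonneg fun X => by positivity
  rw [← hDir]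
  rcases hm0.eq_or_lt with hm0' | hmpos
  · rw [← hm0', mul_zero]
    exact dirichletFormW_self_nonneg L F βc
  -- the normalised state `Ψ = c βc F`
  have hmpos' : 0 < ∫ X in cellN N L, βc X ^ 2 * ‖Φ.ψ X‖ ^ 2 := by
    simp only [hF]; exact hmpos
  obtain ⟨Ψ, c, hΨ⟩ := b3_exists_mulState hreal hβc hβc_symm hmpos'
  have hθ : ContDiff ℝ 1 fun X => c * βc X := contDiff_const.mul hβc.1
  have hθper : IsLatticePeriodic L fun X => c * βc X := fun X i e => by
    show c * βc _ = c * βc X; rw [hβc.2 X i e]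
  have hθsymm : ∀ (σ : Equiv.Perm (Fin N)) (X : Config N),
      (fun X => c * βc X) (X ∘ σ) = (fun X => c * βc X) X := fun σ X => by
    show c * βc (X ∘ σ) = c * βc X; rw [hβc_symm σ X]
  have hΨ' : ∀ X, Ψ.ψ X = (((fun X => c * βc X) X * ‖Φ.ψ X‖ : ℝ) : ℂ) := fun X => by rw [hΨ X]
  -- the measurable weight computing the energy, minimality of `Φ`
  have hW : Measurable (periodicInteraction (N := N) v L) := measurable_periodicInteraction_of hvm L
  have hEW : ∀ Ψ : PeriodicTrialState N L, periodicEnergy v Ψ =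
      ∫⁻ X in cellN N L, kineticDensity Ψ.ψ X +
        periodicInteraction v L X * ((‖Ψ.ψ X‖₊ : ℝ≥0∞)) ^ 2 := fun _ => rfl
  have hmin : ∀ Ψ : PeriodicTrialState N L, periodicEnergy v Φ ≤ periodicEnergy v Ψ :=
    fun Ψ => hE ▸ periodicGroundStateEnergy_le v Ψ
  have hne : periodicEnergy v Ψ ≠ ⊤ := energy_ne_top_of_eq_mul hW hEW hreal hEfin Ψ hθ hΨ'
  -- the ground-state representation `E_v(Ψ) = E₀ + c² 𝓔_F(βc, βc)`
  have hgs := gsRepresentation hW hEW hreal hEfin hmin Ψ hθ hθper hθsymm hΨ'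
  rw [hFfun] at hgs
  have hDθ : dirichletFormW L F (fun X => c * βc X) (fun X => c * βc X) =
      c ^ 2 * dirichletFormW L F βc βc := by
    rw [show (fun X => c * βc X) = c • βc from rfl, dirichletFormW_smul_left,
      dirichletFormW_smul_right]
    ring
  rw [hDθ] at hgs
  -- normalisation `c² m = 1`
  have hnorm : c ^ 2 * m = 1 := by
    have h := integral_norm_sq_eq_one Ψ
    simp_rw [norm_sq_of_eq_mul Φ hΨ', hF] at h
    rw [hm_def, ← integral_const_mul, ← h]
    exact integral_congr_ae (ae_of_all _ fun X => by ring)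
  -- orthogonality `⟨Φ, Ψ⟩ = c ∫ βc F² = 0`
  have horth : ∫ X in cellN N L, conj (Φ.ψ X) * Ψ.ψ X = 0 := by
    have hpt : ∀ X, conj (Φ.ψ X) * Ψ.ψ X = ((c * (βc X * F X ^ 2) : ℝ) : ℂ) := by
      intro X
      rw [hΨ X, hF X, hFr X, Complex.conj_ofReal]
      push_cast
      ring
    simp_rw [hpt]
    rw [integral_complex_ofReal, integral_const_mul, hcent, mul_zero, Complex.ofReal_zero]
  -- the Ky Fan variational principle at the orthogonal pair `(Φ, Ψ)`
  have hK : kyFanTwo v N L ≤ periodicEnergy v Φ + periodicEnergy v Ψ :=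
    iInf_le_of_le Φ (iInf_le_of_le Ψ (iInf_le_of_le horth le_rfl))
  have hchain := hgap.trans hK
  rw [← hE, two_mul, add_assoc, ENNReal.add_le_add_iff_left hEfin] at hchain
  have hreal_ineq : (periodicEnergy v Φ).toReal + γ ≤ (periodicEnergy v Ψ).toReal := by
    have h := ENNReal.toReal_mono hne hchain
    rwa [ENNReal.toReal_add hEfin ENNReal.ofReal_ne_top, ENNReal.toReal_ofReal hγ] at h
  rw [hgs] at hreal_ineq
  -- `γ ≤ c² 𝓔`, multiply by `m` and use `c² m = 1`
  have hγle : γ ≤ c ^ 2 * dirichletFormW L F βc βc := by linarith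
  calc γ * m ≤ c ^ 2 * dirichletFormW L F βc βc * m := mul_le_mul_of_nonneg_right hγle hm0
    _ = dirichletFormW L F βc βc := by rw [mul_right_comm, hnorm, one_mul]

/-! ### Step 2: the zero-mode dictionary bound `∫ (N̂₀F)² ≤ N²` -/

/-- **`‖N̂₀Φ‖² ≤ N²`** for a real periodic trial state `Φ = F` of `N = n + 2` bosons: with
`G = N̂₀F = ∑ⱼ PⱼF`, `∫ G² = T₀ + n₀` (`cm_ofReal_integral_numOp_sq`, `T₀ = ‖a_0a_0Φ‖²` the pair term),
`T₀ ≤ (N−1) n₀` (`pairOcc_le_momentumOccupation`) and `n₀ ≤ N`. [folklore] -/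
theorem zg_integral_numOp_sq_le (hL : 0 < L) (Φ : PeriodicTrialState (n + 2) L)
    {F G : Config (n + 2) → ℝ} (hFr : ∀ X, Φ.ψ X = (F X : ℂ))
    (hG : ∀ X, G X = ∑ j, (L ^ 3)⁻¹ * ∫ y in cell L, F (Function.update X j y)) :
    ∫ X in cellN (n + 2) L, G X ^ 2 ≤ ((n : ℝ) + 2) ^ 2 := by
  have h := cm_ofReal_integral_numOp_sq hL Φ hFr hG
  rw [← pairOcc_zero hL Φ] at h
  have hn0 : condensateOccupation (n + 2) L Φ.ψ ≤ ((n + 2 : ℕ) : ℝ≥0∞) :=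
    condensateOccupation_le_card hL Φ
  have hpair : pairOcc L 0 Φ.ψ ≤ ((n + 1 : ℕ) : ℝ≥0∞) * ((n + 2 : ℕ) : ℝ≥0∞) :=
    calc pairOcc L 0 Φ.ψ ≤ ((n + 1 : ℕ) : ℝ≥0∞) * momentumOccupation (n + 2) L 0 Φ.ψ :=
          pairOcc_le_momentumOccupation hL Φ 0
      _ = ((n + 1 : ℕ) : ℝ≥0∞) * condensateOccupation (n + 2) L Φ.ψ := by
          rw [momentumOccupation_zero]
      _ ≤ ((n + 1 : ℕ) : ℝ≥0∞) * ((n + 2 : ℕ) : ℝ≥0∞) := by gcongr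
  have hcast : ((n + 1 : ℕ) : ℝ≥0∞) * ((n + 2 : ℕ) : ℝ≥0∞) + ((n + 2 : ℕ) : ℝ≥0∞) =
      ENNReal.ofReal (((n : ℝ) + 2) ^ 2) := by
    have e : ENNReal.ofReal (((n : ℝ) + 2) ^ 2) = (((n + 2) ^ 2 : ℕ) : ℝ≥0∞) := by
      rw [← ENNReal.ofReal_natCast]; congr 1; push_cast; ring
    rw [e]; push_cast; ring
  have hle : ENNReal.ofReal (∫ X in cellN (n + 2) L, G X ^ 2) ≤ ENNReal.ofReal (((n : ℝ) + 2) ^ 2) := by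
    rw [h, ← hcast]
    exact add_le_add hpair hn0
  exact (ENNReal.ofReal_le_ofReal_iff (by positivity)).1 hle

/-! ### Step 3: the `H₋₁` bound on the centred counting ratio -/

/-- **`‖g − ⟨g⟩‖²₋₁ ≤ N²/γ` from the Ky Fan gap.** Let `Φ = F > 0` be a real nowhere-vanishing
finite-energy minimiser of `N = n + 2` bosons with Ky Fan gap `2E₀ + γ ≤ kyFanTwo v N L`, `γ > 0`,
`G = N̂₀F = ∑ⱼ L⁻³∫_cell F(X; xⱼ ↦ y)dy` and `g = G/F`. Then
`hMinusOneSqW L F (g − ∫gF²) ≤ N²/γ`: by `hMinusOneSqW_le_of_symmetric_tests` it suffices to bound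
`2∫(g−⟨g⟩)βF² − 𝓔_F(β,β)` for Bose-symmetric periodic tests `β`; there
`∫(g−⟨g⟩)βF² = ∫(g−⟨g⟩)(β−β̄)F²`, Cauchy–Schwarz, `∫(g−⟨g⟩)²F² ≤ ∫G² ≤ N²` and the Poincaré inequality
`γ∫(β−β̄)²F² ≤ 𝓔_F(β,β)` (`zg_poincare_of_kyFanGap`) give `(∫(g−⟨g⟩)βF²)² ≤ (N²/γ)𝓔_F(β,β)`.
[cite: KipnisVaradhan1986, (1.14)] -/
theorem zg_hMinusOneSqW_le_of_kyFanGap (hL : 0 < L) {v : ℝ → ℝ≥0∞} (hvm : Measurable v)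
    (Φ : PeriodicTrialState (n + 2) L) (hreal : ∀ X, Φ.ψ X = (‖Φ.ψ X‖ : ℂ)) (hpos : ∀ X, Φ.ψ X ≠ 0)
    (hE : periodicEnergy v Φ = periodicGroundStateEnergy v (n + 2) L) (hEfin : periodicEnergy v Φ ≠ ⊤)
    {γ : ℝ} (hγ : 0 < γ)
    (hgap : 2 * periodicGroundStateEnergy v (n + 2) L + ENNReal.ofReal γ ≤ kyFanTwo v (n + 2) L)
    {F G : Config (n + 2) → ℝ} (hF : ∀ X, ‖Φ.ψ X‖ = F X)
    (hG : ∀ X, G X = ∑ j, (L ^ 3)⁻¹ * ∫ y in cell L, F (Function.update X j y)) :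
    hMinusOneSqW L F (fun X => G X / F X - ∫ Y in cellN (n + 2) L, G Y / F Y * F Y ^ 2) ≤
      ENNReal.ofReal (((n : ℝ) + 2) ^ 2 / γ) := by
  have hFr : ∀ X, Φ.ψ X = (F X : ℂ) := fun X => by rw [← hF X]; exact hreal X
  have hFt : IsPeriodicTest L F := zf_F_isPeriodicTest Φ hreal hF
  have hFsymm : ∀ (σ : Equiv.Perm (Fin (n + 2))) (X : Config (n + 2)), F (X ∘ σ) = F X :=
    zf_F_symm Φ hF
  have hF0 : ∀ X, 0 < F X := zf_F_pos Φ hpos hF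
  have hF1 : ∫ X in cellN (n + 2) L, F X ^ 2 = 1 := zf_integral_F_sq Φ hF
  have hFc : Continuous F := hFt.continuous
  -- `G = N̂₀F` is a Bose-symmetric periodic test function
  have hGt : IsPeriodicTest L G :=
    zf_isPeriodicTest_u hL hFt hFsymm
      (uu := fun m X => (L ^ 3)⁻¹ * ∫ y in cell L, F (Function.update X m y)) (fun _ _ => rfl) hG
  have hGsymm : ∀ (σ : Equiv.Perm (Fin (n + 2))) (X : Config (n + 2)), G (X ∘ σ) = G X :=
    zf_u_comp_perm hFsymm
      (uu := fun m X => (L ^ 3)⁻¹ * ∫ y in cell L, F (Function.update X m y)) (fun _ _ => rfl) hG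
  have hGc : Continuous G := hGt.continuous
  have hG2 : ∫ X in cellN (n + 2) L, G X ^ 2 ≤ ((n : ℝ) + 2) ^ 2 := zg_integral_numOp_sq_le hL Φ hFr hG
  -- the ratio `g = G/F`, its mean `gbar` and its centring `gc`
  obtain ⟨g, hg_def⟩ : ∃ g : Config (n + 2) → ℝ, g = fun X => G X / F X := ⟨_, rfl⟩
  have hgX : ∀ X, G X / F X = g X := fun X => by rw [hg_def]
  simp only [hgX]
  set gbar : ℝ := ∫ Y in cellN (n + 2) L, g Y * F Y ^ 2 with hgbar_def
  obtain ⟨gc, hgc_def⟩ : ∃ gc : Config (n + 2) → ℝ, gc = fun X => g X - gbar := ⟨_, rfl⟩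
  have hgcX : ∀ X, g X - gbar = gc X := fun X => by rw [hgc_def]
  simp only [hgcX]
  have hg_cont : Continuous g := by rw [hg_def]; exact hGc.div hFc fun X => (hF0 X).ne'
  have hg_symm : ∀ (σ : Equiv.Perm (Fin (n + 2))) (X : Config (n + 2)), g (X ∘ σ) = g X :=
    fun σ X => by simp only [hg_def, hGsymm σ X, hFsymm σ X]
  have hgc_cont : Continuous gc := by rw [hgc_def]; exact hg_cont.sub continuous_const
  have hgc_symm : ∀ (σ : Equiv.Perm (Fin (n + 2))) (X : Config (n + 2)), gc (X ∘ σ) = gc X :=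
    fun σ X => by simp only [hgc_def, hg_symm σ X]
  -- `gc` is centred
  have hcent : ∫ X in cellN (n + 2) L, gc X * F X ^ 2 = 0 := by
    have i1 : IntegrableOn (fun X => g X * F X ^ 2) (cellN (n + 2) L) :=
      integrableOn_cellN (hg_cont.mul (hFc.pow 2)) L
    have i2 : IntegrableOn (fun X => gbar * F X ^ 2) (cellN (n + 2) L) :=
      integrableOn_cellN (continuous_const.mul (hFc.pow 2)) L
    have hpt : ∀ X, gc X * F X ^ 2 = g X * F X ^ 2 - gbar * F X ^ 2 := fun X => by
      rw [hgc_def]; ring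
    simp_rw [hpt]
    rw [integral_sub i1 i2, integral_const_mul, hF1, ← hgbar_def]
    ring
  -- the variance bound `∫ gc² F² = ∫ G² - gbar² ≤ N²`
  have hm' : ∫ X in cellN (n + 2) L, F X * G X = gbar := by
    rw [hgbar_def]
    refine integral_congr_ae (ae_of_all _ fun X => ?_)
    show F X * G X = g X * F X ^ 2
    rw [hg_def]
    field_simp [(hF0 X).ne']
  have hVar : ∫ X in cellN (n + 2) L, gc X ^ 2 * F X ^ 2 ≤ ((n : ℝ) + 2) ^ 2 := by
    have hPyth := vhr_integral_centredRatio_sq L hFc hF0 hGc gbar hm' hF1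
    have e : ∫ X in cellN (n + 2) L, gc X ^ 2 * F X ^ 2 =
        ∫ X in cellN (n + 2) L, (G X / F X - gbar) * (G X / F X - gbar) * F X ^ 2 :=
      integral_congr_ae (ae_of_all _ fun X => by simp only [hgc_def, hg_def]; ring)
    rw [e, hPyth]
    nlinarith [hG2, sq_nonneg gbar]
  -- symmetric tests suffice
  have hB : 0 ≤ ((n : ℝ) + 2) ^ 2 / γ := by positivity
  refine hMinusOneSqW_le_of_symmetric_tests L hgc_cont hgc_symm hFc hFsymm fun β hβ hβsymm => ?_
  -- the Poincaré inequality for `β`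
  have hP := zg_poincare_of_kyFanGap hvm Φ hreal hE hEfin hF hγ.le hgap hβ hβsymm
  set bbar : ℝ := ∫ Y in cellN (n + 2) L, β Y * F Y ^ 2 with hbbar
  set a : ℝ := ∫ X in cellN (n + 2) L, F X ^ 2 * (β X * gc X) with ha_def
  set D : ℝ := ∫ X in cellN (n + 2) L, F X ^ 2 * gradDot β β X with hD_def
  have hD : D = dirichletFormW L F β β := by
    rw [hD_def, dirichletFormW]
    exact integral_congr_ae (ae_of_all _ fun X => mul_comm _ _)
  have hD0 : 0 ≤ D := hD ▸ dirichletFormW_self_nonneg L F β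
  have hm0 : 0 ≤ ∫ X in cellN (n + 2) L, (β X - bbar) ^ 2 * F X ^ 2 :=
    integral_nonneg fun X => by positivity
  -- `a = ∫ (gc F) ((β - β̄) F)` since `gc` is centred
  have ha : a = ∫ X in cellN (n + 2) L, gc X * F X * ((β X - bbar) * F X) := by
    have i1 : IntegrableOn (fun X => gc X * F X * ((β X - bbar) * F X)) (cellN (n + 2) L) :=
      integrableOn_cellN ((hgc_cont.mul hFc).mul ((hβ.continuous.sub continuous_const).mul hFc)) L
    have i2 : IntegrableOn (fun X => bbar * (gc X * F X ^ 2)) (cellN (n + 2) L) :=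
      integrableOn_cellN (continuous_const.mul (hgc_cont.mul (hFc.pow 2))) L
    have hpt : ∀ X, F X ^ 2 * (β X * gc X) =
        gc X * F X * ((β X - bbar) * F X) + bbar * (gc X * F X ^ 2) := fun X => by ring
    rw [ha_def, integral_congr_ae (ae_of_all _ hpt), integral_add i1 i2, integral_const_mul, hcent,
      mul_zero, add_zero]
  -- Cauchy–Schwarz
  have hCS : (∫ X in cellN (n + 2) L, gc X * F X * ((β X - bbar) * F X)) ^ 2 ≤
      (∫ X in cellN (n + 2) L, (gc X * F X) ^ 2) * ∫ X in cellN (n + 2) L, ((β X - bbar) * F X) ^ 2 :=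
    sq_integral_cellN_mul_le (hgc_cont.mul hFc) ((hβ.continuous.sub continuous_const).mul hFc) L
  have e1 : ∫ X in cellN (n + 2) L, (gc X * F X) ^ 2 = ∫ X in cellN (n + 2) L, gc X ^ 2 * F X ^ 2 :=
    integral_congr_ae (ae_of_all _ fun X => by ring)
  have e2 : ∫ X in cellN (n + 2) L, ((β X - bbar) * F X) ^ 2 =
      ∫ X in cellN (n + 2) L, (β X - bbar) ^ 2 * F X ^ 2 :=
    integral_congr_ae (ae_of_all _ fun X => by ring)
  have ha2 : a ^ 2 ≤ ((n : ℝ) + 2) ^ 2 / γ * D :=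
    calc a ^ 2 = (∫ X in cellN (n + 2) L, gc X * F X * ((β X - bbar) * F X)) ^ 2 := by rw [ha]
      _ ≤ (∫ X in cellN (n + 2) L, (gc X * F X) ^ 2) *
            ∫ X in cellN (n + 2) L, ((β X - bbar) * F X) ^ 2 := hCS
      _ = (∫ X in cellN (n + 2) L, gc X ^ 2 * F X ^ 2) *
            ∫ X in cellN (n + 2) L, (β X - bbar) ^ 2 * F X ^ 2 := by rw [e1, e2]
      _ ≤ ((n : ℝ) + 2) ^ 2 * ∫ X in cellN (n + 2) L, (β X - bbar) ^ 2 * F X ^ 2 :=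
          mul_le_mul_of_nonneg_right hVar hm0
      _ ≤ ((n : ℝ) + 2) ^ 2 * (D / γ) := by
          refine mul_le_mul_of_nonneg_left ?_ (by positivity)
          rw [le_div_iff₀ hγ, mul_comm, hD]; exact hP
      _ = ((n : ℝ) + 2) ^ 2 / γ * D := by field_simp
  exact zg_two_mul_sub_le_of_sq_le hB hD0 ha2

/-! ### The registered sub-stub -/

/-- **Gap ⇒ zero-mode susceptibility (sufficient condition for S3b `stub_zeroModeSusceptibility`).**
For a smooth-class pair potential `v`, IF the bosonic torus gap exceeds every multiple of `L⁻³`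
density-uniformly on the dilute side — for every `C > 0` there is `ρ₀ > 0` such that for all large `n`
and every `L ≥ sideLength ρ₀ (n+2)`, `2E₀(n+2, L) + C/L³ ≤ kyFanTwo v (n+2) L` — THEN the body of
`stub_zeroModeSusceptibility` holds: for every `ζ > 0`, `A ≥ 0` there is `ρ₀ > 0` such that eventually in
`n`, for every `L ≥ sideLength ρ₀ (n+2)` and every real non-negative nowhere-vanishing finite-energy `C³`
minimiser `Φ` of `n + 2` bosons there is `B ≥ 0` with `‖g_Φ − ⟨g_Φ⟩‖²₋₁ ≤ B` and
`A·((n+2)/L³)·(n+2)·B ≤ (ζ(n+2)²)²`, `g_Φ = (N̂₀Φ)/Φ` the zero-mode counting ratio. Take `C = (A+1)/ζ²`,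
`γ = C/L³`, `B = (n+2)²L³/C` (`zg_hMinusOneSqW_le_of_kyFanGap`: Poincaré from Ky Fan, Cauchy–Schwarz and
the zero-mode dictionary); `A(n+2)⁴/C = ζ²(n+2)⁴·A/(A+1) ≤ (ζ(n+2)²)²`. The hypotheses `hfin`, `hC2`,
`hedge` and `C³` are not used. [cite: ReedSimonIV1978, Thm XIII.1–2] -/
theorem zeroModeSusceptibility_of_torusGap (v : ℝ → ℝ≥0∞) (hv : IsRepulsiveFiniteRange v)
    (hfin : ∀ r, v r ≠ ⊤) (hC2 : ContDiff ℝ 2 (fun x : Space => (v ‖x‖).toReal))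
    (hedge : ∃ Cₑ : ℝ, ∀ x : Space,
      ‖iteratedFDeriv ℝ 2 (fun x : Space => (v ‖x‖).toReal) x‖ ≤ Cₑ * Real.sqrt ((v ‖x‖).toReal))
    (hGap : ∀ C : ℝ, 0 < C → ∃ ρ₀ : ℝ, 0 < ρ₀ ∧ ∀ᶠ n : ℕ in atTop, ∀ L : ℝ,
      sideLength ρ₀ (n + 2) ≤ L →
        2 * periodicGroundStateEnergy v (n + 2) L + ENNReal.ofReal (C / L ^ 3) ≤ kyFanTwo v (n + 2) L) :
    ∀ ζ : ℝ, 0 < ζ → ∀ A : ℝ, 0 ≤ A → ∃ ρ₀ : ℝ, 0 < ρ₀ ∧ ∀ᶠ n : ℕ in atTop, ∀ L : ℝ,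
      sideLength ρ₀ (n + 2) ≤ L → ∀ Φ : PeriodicTrialState (n + 2) L,
        periodicEnergy v Φ = periodicGroundStateEnergy v (n + 2) L → periodicEnergy v Φ ≠ ⊤ →
        ContDiff ℝ 3 Φ.ψ → (∀ X, Φ.ψ X = (‖Φ.ψ X‖ : ℂ)) → (∀ X, Φ.ψ X ≠ 0) →
        ∃ B : ℝ, 0 ≤ B ∧
          hMinusOneSqW L (fun X => ‖Φ.ψ X‖)
              (fun X => (∑ j, (L ^ 3)⁻¹ * ∫ y in cell L, ‖Φ.ψ (Function.update X j y)‖) / ‖Φ.ψ X‖ -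
                ∫ Y in cellN (n + 2) L,
                  (∑ j, (L ^ 3)⁻¹ * ∫ y in cell L, ‖Φ.ψ (Function.update Y j y)‖) / ‖Φ.ψ Y‖ *
                    ‖Φ.ψ Y‖ ^ 2) ≤ ENNReal.ofReal B ∧
          A * (((n : ℝ) + 2) / L ^ 3) * ((n : ℝ) + 2) * B ≤ (ζ * ((n : ℝ) + 2) ^ 2) ^ 2 := by
  have _ := hfin; have _ := hC2; have _ := hedge
  have hvm : Measurable v := hv.1
  intro ζ hζ A hA
  set C : ℝ := (A + 1) / ζ ^ 2 with hC_def
  have hCpos : 0 < C := by positivity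
  obtain ⟨ρ₀, hρ₀, hev⟩ := hGap C hCpos
  refine ⟨ρ₀, hρ₀, ?_⟩
  filter_upwards [hev] with n hn L hLle Φ hE hEfin _ hreal hpos
  have hL : 0 < L :=
    (Real.rpow_pos_of_pos (div_pos (Nat.cast_pos.2 (Nat.succ_pos _)) hρ₀) _).trans_le hLle
  have hγ : 0 < C / L ^ 3 := by positivity
  refine ⟨((n : ℝ) + 2) ^ 2 / (C / L ^ 3), by positivity, ?_, ?_⟩
  · exact zg_hMinusOneSqW_le_of_kyFanGap hL hvm Φ hreal hpos hE hEfin hγ (hn L hLle)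
      (F := fun X => ‖Φ.ψ X‖)
      (G := fun X => ∑ j, (L ^ 3)⁻¹ * ∫ y in cell L, ‖Φ.ψ (Function.update X j y)‖)
      (fun _ => rfl) (fun _ => rfl)
  · have key : A * (((n : ℝ) + 2) / L ^ 3) * ((n : ℝ) + 2) * (((n : ℝ) + 2) ^ 2 / (C / L ^ 3)) =
        A / (A + 1) * (ζ * ((n : ℝ) + 2) ^ 2) ^ 2 := by
      rw [hC_def]; field_simp
    rw [key]
    have h1 : A / (A + 1) ≤ 1 := by rw [div_le_one (by positivity)]; linarith
    calc A / (A + 1) * (ζ * ((n : ℝ) + 2) ^ 2) ^ 2 ≤ 1 * (ζ * ((n : ℝ) + 2) ^ 2) ^ 2 :=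
          mul_le_mul_of_nonneg_right h1 (sq_nonneg _)
      _ = (ζ * ((n : ℝ) + 2) ^ 2) ^ 2 := one_mul _

end Summit.AtomisticToContinuum.BoseEinsteinCondensation.Theorems.CorrectorClosure.VolumeHomotopySumRuleDomination

end
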